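import Mathlib
import HarnessLib
import Summits.PneNP.PneNP.Theses.RamseyAliens
import Literature.Computability.MetaComplexity.UniversalMachineProofs
import Literature.Computability.MetaComplexity.RamseyTautologies

/-!
# Line `igt-simulation` — skeleton for the piece `IncompressibleGivesTarget` (stmt-PneNP-2280)
of the split `NoExtremalPrinter ⇐ ExtremalIncompressible ∧ IncompressibleGivesTarget`
(route `RamseyAliens`, deciding crux stmt-PneNP-2270; crux-strategist BC2 redirect, 2026-08-17)

`IncompressibleGivesTarget := ExtremalIncompressible → NoExtremalPrinter` — the ROUTINE half of the bridge
split (the "Ribet step"): an output-polynomial extremal printer is a short, fast description of the extremal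
colourings it prints, so it contradicts their time-bounded incompressibility as soon as `m = R(k) − 1`
outgrows `k`.  `R(k) = R(k,k)` is the tree's `Literature.Computability.MetaComplexity.diagonalRamsey k`
(by `rfl` the route's inlined `sInf {m | ∀ G : SimpleGraph (Fin m), ¬G.CliqueFree k ∨ ¬Gᶜ.CliqueFree k}`).

Composition (kernel-checked below, `IncompressibleGivesTarget_of`):

* `stub_printerCompresses` (M, provable now): if `f` is printed within `c·R(k)^c + c` TM2 steps on the
  unary input `1^k` and `|V(f k)| + 1 = R(k)` for `k ≥ 2`, then for EVERY efficient universal machine `U`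
  there are `c', C` with `K_U^{(R(k)−1)^{c'} + c'}(code (f k)) ≤ k + C` for all `k ≥ 2`.  Plan: the printer's
  machine `M` has `M.OutputsWithin (unaryEncodeNat k) (code (f k)) (c·R(k)^c + c)` (`|unaryEncodeNat k| = k`,
  `Computability.unary_decode_encode_nat`); `U.exists_ktAt_le_of_outputsWithin M` gives a code `e` and an
  overhead polynomial `p` with `K_U^{p(c·R^c + c)} ≤ k + 2|e| + 2`; polynomial domination
  `p(c·(m+1)^c + c) ≤ m^{c'} + c'` for `m = R(k) − 1 ≥ 1` (`k ≥ 2` forces `R(k) ≥ 2`: the one-vertex graph is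
  `k`-Ramsey) and `U.ktAt_anti` finish.
* `stub_ramseyOutgrowsPolynomials` (S/M, provable now): for every `δ > 0` and `C`, eventually
  `k + C < (R(k) − 1)^δ`.  Plan: `RamseyTautologiesProofs.exists_extremal` gives `R(k) − 1 ≥ 2^{⌊k/4⌋}` for
  `k ≥ 16` (Erdős 1947 + Erdős–Szekeres, both discharged in the tree), and `k + C = o(2^{δ⌊k/4⌋})`.
* `IncompressibleGivesTarget_of : stub_printerCompresses → stub_ramseyOutgrowsPolynomials →
  IncompressibleGivesTarget` (PROVED here, no sorry): pick `U` from `UniversalMachine.nonempty_holds`,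
  `(c', C)` from Stub 1, `δ` and the frequent `k` from `ExtremalIncompressible U c'`, intersect with the
  eventual `k` of Stub 2 and `k ≥ 2`, and read off `m^δ ≤ ⌈m^δ⌉ ≤ K ≤ k + C < m^δ` at `m = R(k) − 1`.

Conventions: `sorry` appears ONLY in `stub_*`; stub signatures use only Mathlib / Literature / route vocabulary.
-/

set_option linter.dupNamespace false

namespace Summit.PneNP.PneNP.Cruxes.NoExtremalPrinter.IgtSimulation

open Literature.Computability.Complexity
open Literature.Computability.MetaComplexity
open Summit.PneNP.PneNP.Theses.RamseyAliens (ExtremalIncompressible NoExtremalPrinter IncompressibleGivesTarget)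

noncomputable section

/-! ### The registered stubs (`sorry` lives ONLY here) -/

/-- **Stub 1 — a fast printer compresses what it prints (simulation; provable now, M).** If `f` is TM2-computable
on unary input `1^k` within `c·R(k)^c + c` steps with output `encodingGraph.encode (f k)`, and `|V(f k)| + 1 = R(k)`
for `k ≥ 2`, then for every efficient universal machine `U` there are constants `c', C` such that
`K_U^{(R(k)−1)^{c'}+c'}(encodingGraph.encode (f k)) ≤ k + C` for all `k ≥ 2`: the program is `boolPair e (1^k)`
(`UniversalMachine.sim` / `exists_ktAt_le_of_outputsWithin`), the budget `p(c·R^c + c)` is dominated by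
`(R−1)^{c'} + c'` because `R(k) − 1 ≥ 1` for `k ≥ 2`, and `K^t` is antitone in `t` (`ktAt_anti`). -/
theorem stub_printerCompresses :
    ∀ (U : UniversalMachine) (c : ℕ) (f : ℕ → Σ n, SimpleGraph (Fin n)),
      TimeComputable Computability.unaryEncodeNat encodingGraph.encode f
          (fun k => c * diagonalRamsey k ^ c + c) →
      (∀ k, 2 ≤ k → (f k).1 + 1 = diagonalRamsey k) →
      ∃ c' C : ℕ, ∀ k, 2 ≤ k →
        U.ktAt ((diagonalRamsey k - 1) ^ c' + c') (encodingGraph.encode (f k)) ≤ ((k + C : ℕ) : ℕ∞) := by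
  sorry

/-- **Stub 2 — `R(k) − 1` outgrows every polynomial (provable now, S/M).** For every `δ > 0` and every `C`,
eventually `k + C < (R(k) − 1)^δ` (real power).  From `RamseyTautologiesProofs.exists_extremal`
(`R(k) − 1 ≥ 2^{⌊k/4⌋}` for `k ≥ 16`, i.e. Erdős 1947 `erdos1947_ramsey_lower_holds` + `erdos_condition` + the
Erdős–Szekeres nonemptiness `ramsey_diagonal_le_four_pow_holds`) and `k + C < 2^{δ⌊k/4⌋}` for large `k`. -/
theorem stub_ramseyOutgrowsPolynomials :
    ∀ δ : ℝ, 0 < δ → ∀ C : ℕ, ∀ᶠ k in Filter.atTop,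
      ((k + C : ℕ) : ℝ) < (((diagonalRamsey k - 1 : ℕ) : ℝ)) ^ δ := by
  sorry

/-! ### Name-keyed statements of the stubs (the hypotheses of the composition) -/
namespace Registered

/-- Statement of Stub 1. -/
abbrev stub_printerCompresses : Prop :=
  ∀ (U : UniversalMachine) (c : ℕ) (f : ℕ → Σ n, SimpleGraph (Fin n)),
    TimeComputable Computability.unaryEncodeNat encodingGraph.encode f
        (fun k => c * diagonalRamsey k ^ c + c) →
    (∀ k, 2 ≤ k → (f k).1 + 1 = diagonalRamsey k) →
    ∃ c' C : ℕ, ∀ k, 2 ≤ k →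
      U.ktAt ((diagonalRamsey k - 1) ^ c' + c') (encodingGraph.encode (f k)) ≤ ((k + C : ℕ) : ℕ∞)

/-- Statement of Stub 2. -/
abbrev stub_ramseyOutgrowsPolynomials : Prop :=
  ∀ δ : ℝ, 0 < δ → ∀ C : ℕ, ∀ᶠ k in Filter.atTop,
    ((k + C : ℕ) : ℝ) < (((diagonalRamsey k - 1 : ℕ) : ℝ)) ^ δ

end Registered

/-! ### The composition (proved, no `sorry`) -/

/-- **`IncompressibleGivesTarget` from the two stubs.** Given an output-polynomial extremal printer `(c, f)`
(the negation of `NoExtremalPrinter`), fix an efficient universal machine `U` (`UniversalMachine.nonempty_holds`),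
let `(c', C)` be the compression constants of Stub 1 and `δ > 0` with its frequent set of `k` be given by
`ExtremalIncompressible U c'`; on a `k ≥ 2` in that frequent set where also Stub 2 holds (frequent ∧ eventual
is frequent), the printed colouring `G = (f k).2` on `m = R(k) − 1` vertices is extremal, so
`⌈m^δ⌉ ≤ K_U^{m^{c'}+c'}(code ⟨m, G⟩) ≤ k + C < m^δ` — absurd. -/
theorem IncompressibleGivesTarget_of
    (hPC : Registered.stub_printerCompresses) (hG : Registered.stub_ramseyOutgrowsPolynomials) :
    IncompressibleGivesTarget := by
  intro hEI hX
  obtain ⟨c, f, hT, hf⟩ := hX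
  obtain ⟨U⟩ := UniversalMachine.nonempty_holds
  obtain ⟨c', C, hK⟩ := hPC U c f hT (fun k hk => (hf k hk).1)
  obtain ⟨δ, hδ, hfreq⟩ := hEI U c'
  obtain ⟨k, hkall, hk2, hlt⟩ :=
    (hfreq.and_eventually ((Filter.eventually_ge_atTop 2).and (hG δ hδ C))).exists
  obtain ⟨hsize, hcf, hccf⟩ := hf k hk2
  have hKk := hK k hk2
  -- name the printed colouring
  rcases hfk : f k with ⟨n, G⟩
  rw [hfk] at hsize hcf hccf hKk
  dsimp only at hsize hcf hccf
  have hn : diagonalRamsey k - 1 = n := by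
    change n + 1 = diagonalRamsey k at hsize
    omega
  -- transport the incompressibility of extremal colourings on `Fin (R k - 1)` to `Fin n`
  have key : ∀ m : ℕ, m = n →
      (∀ G' : SimpleGraph (Fin m), G'.CliqueFree k → G'ᶜ.CliqueFree k →
        ((⌈((m : ℕ) : ℝ) ^ δ⌉₊ : ℕ) : ℕ∞) ≤ U.ktAt (m ^ c' + c') (encodingGraph.encode ⟨m, G'⟩)) →
      ((⌈((n : ℕ) : ℝ) ^ δ⌉₊ : ℕ) : ℕ∞) ≤ U.ktAt (n ^ c' + c') (encodingGraph.encode ⟨n, G⟩) := by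
    rintro m rfl h
    exact h G hcf hccf
  have hlow := key (diagonalRamsey k - 1) hn hkall
  rw [hn] at hKk hlt
  have h1 : ((⌈((n : ℕ) : ℝ) ^ δ⌉₊ : ℕ) : ℕ∞) ≤ ((k + C : ℕ) : ℕ∞) := hlow.trans hKk
  have h2 : ⌈((n : ℕ) : ℝ) ^ δ⌉₊ ≤ k + C := by exact_mod_cast h1
  have h3 : ((n : ℕ) : ℝ) ^ δ ≤ ((k + C : ℕ) : ℝ) := (Nat.le_ceil _).trans (by exact_mod_cast h2)
  exact absurd hlt (not_lt.mpr h3)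

end

end Summit.PneNP.PneNP.Cruxes.NoExtremalPrinter.IgtSimulation
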